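import Summits.HubbardSuperconductivity.HubbardSuperconductivity.Theses.AposterioriCapRg
import Literature.MathematicalPhysics.QuantumLattice.DWaveOrderParameterProofs
import Literature.Analysis.Complex.CauchyTaylorBall

/-!
# Crux `AposterioriOrderCriterionR` (item `stmt-HubbardSuperconductivity-13884`) — line skeleton
# `cauchy-griffiths-source-shells` (lead prover, attempt 0)

Target: `Summit.HubbardSuperconductivity.HubbardSuperconductivity.Theses.AposterioriCapRg.AposterioriOrderCriterionR`
(route AposterioriCapRg, rank 5):
`∃ kStar etaStar > 0, ∀ U μ h₀ (D : HubbardScaleData), 0 < h₀ → (∀ h ∈ Ioc 0 h₀, ∃ L₀,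
D.IsCertifiedEnclosure (hubbardScaleReportCT U μ D h) L₀) → D.MeetsThresholds kStar etaStar →
(D.meanFieldDensity.fst : ℝ)/2 ≤ dWaveOrderParameter U μ`.

LINE (idea card `Cruxes/AposterioriOrderCriterionR/Ideas/cauchy-griffiths-source-shells.md`): prove R through the
sourced VACUUM ENERGY `E_L(t) = E₀(dWaveSourceTorus L U μ t)` alone. Writing `A_L(h) = (E_L(h) − E_L(2h))/(hL²)`
(so `2 m_L(h) ≤ A_L(h) ≤ 2 m_L(2h)` by the tree's chord inequality `dWaveSourceDensity_mul_le_groundEnergy_drop`,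
`m_L = dWaveSourceDensity L U μ`), the dyadic second difference `D_L(h) = A_L(h) − A_L(h/2) ≥ 0` telescopes:
`Σ_{j ≤ J} D_L(h₀2^{-j}) = A_L(h₀) − A_L(h₀2^{-J-1})`. Hence (stub `stub_slopeTransfer`, pure bookkeeping) a floor
`m₁ ≤ liminf_L m_{L+1}(h₀)` at the TOP stair plus a summable budget `D_{L+1}(h) ≤ 2Φ(h)`, `Σ_j Φ(h₀2^{-j}) ≤ Φtot`
gives `m₁ − Φtot ≤ dWaveOrderParameter U μ` (monotonicity of the stairs fills the dyadic gaps,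
`le_dWaveOrderParameter_of_forall` closes). The budget comes from ANALYTICITY IN THE COMPLEX SOURCE (stub
`stub_shellCurvatureBudget`, pure complex analysis over the tree's `Literature.Analysis.Complex.CauchyTaylorBall`):
if on the window `[h/2, 2h]` the energy is `a + bt + Σ_i Re g_i(t)` with each `g_i` holomorphic on the `r_i`-balls about
the window and oscillating by at most `s_i` there, Cauchy's inequality `‖g''‖ ≤ 8 s/r²` and Taylor–Lagrange give
`3E(h) − E(2h) − 2E(h/2) ≤ 6h² Σ_i s_i/r_i²`. ALL the physics is in ONE stub, `stub_sourceAnalyticShells` = the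
card's Transfer `C⁺ = SourceAnalyticShells(a,b)` together with its "one massive computation at h₀": under R's
hypotheses and `0 < m₀.fst`, (a) the top-stair floor `(3/4)·fst ≤ liminf_L m_{L+1}(h₀)` and (b) for every stair
`h ∈ (0, h₀]`, eventually in `L`, a finite decomposition of `E_{L+1}` on `[h/2,2h]` into an affine part plus real parts
of holomorphic pieces (the dyadic energy SHELLS `e_ℓ`, `ℓ ∈ [ω₀(h)/c, Λ₀]`, each analytic on source discs of
radius `r_ℓ ≍ ρ_s ℓ²/m₀` with `h`-sensitive modulus `s_ℓ ≍ c ℓ³(1+η)`) whose curvature budget `6h Σ s_i/r_i²` is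
`≤ 2Φ(h)(L+1)²` with `Σ_j Φ(h₀2^{-j}) ≤ fst/4` (the card's "curvature loss `h^{-1/2}`-integrable = d_eff 3").
Composition (`AposterioriOrderCriterionR_of`, sorry-free): `fst ≤ 0` is free (`dWaveOrderParameter_nonneg`);
otherwise (a)+(b)+the two mathematical stubs give `(3/4)fst − fst/4 = fst/2 ≤ dWaveOrderParameter U μ`.

WHAT THE LINE CONSUMES of R's hypothesis (honouring `Disproof.lean`: `aposterioriOrderCriterionR_false_without_enclosure`,
`conclusion_iff_stairs`, `mem_reportCTAt_noPatch_velocities`): only inside `stub_sourceAnalyticShells` — the enclosure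
(`m₀`, `ρ_s`, `κ`, `η` of the realised tuples) and the two threshold clauses with content on 0-patch data,
`(kStar Λ₀)² ≤ ρ_s κ` (slope/curvature sums) and `η ≤ etaStar`; no velocity or gap clause is needed by the bookkeeping.

KNOWN STATEMENT-LEVEL CAVEATS (inherited from R, not repairable inside a line; recorded for the planner):
(X1) `hubbardScaleReportCT U μ` is a Grassmann object at chemical potential `μ`; with the tree's symmetric
Matsubara truncation its quartic vertex realises `U(n↑−½)(n↓−½)`, i.e. the OPERATOR model `dWaveSourceTorus L U (μ+U/2)`
(refuter rattack-14045, ATTACK_14045.md on this item), while R — and therefore `stub_sourceAnalyticShells` — compares it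
with energies / the order parameter of `dWaveSourceTorus L U μ`. (X2) 0-patch data are admitted by R.
(X3) `stub_sourceAnalyticShells` (b) asks `E_{L+1}` to be real-analytic on `[h/2,2h]` eventually in `L`: it therefore
also carries source-gapped uniqueness (no ground-state level crossing in the window at large `L`).

No definition is introduced (every stub is spelled out); imports: the route file, `DWaveOrderParameterProofs`,
`Literature.Analysis.Complex.CauchyTaylorBall`.
-/

noncomputable section

namespace Summit.HubbardSuperconductivity.HubbardSuperconductivity.Theorems

open Literature.MathematicalPhysics.QuantumLattice Literature.Probability.LatticeModels
open Summit.HubbardSuperconductivity.HubbardSuperconductivity.Theses.AposterioriCapRg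
open Filter Set

/-! ### Stub M3 — slope transfer (concavity bookkeeping; provable from the tree's chord inequalities) -/

/-- **Slope transfer** (line cauchy-griffiths-source-shells, stub M3; pure bookkeeping). With
`E_L(t) = E₀(dWaveSourceTorus L U μ t)`: a floor `m₁ ≤ liminf_L dWaveSourceDensity (L+1) U μ h₀` at the top stair
and, at every stair `h ∈ (0, h₀]`, eventually in `L`, the dyadic second-difference bound
`(E(h)−E(2h))/h − (E(h/2)−E(h))/(h/2) ≤ 2Φ(h)(L+1)²` with `Σ_{j≤J} Φ(h₀/2^j) ≤ Φtot` for all `J`, give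
`m₁ − Φtot ≤ dWaveOrderParameter U μ` (chords `2m(h) ≤ A(h) ≤ 2m(2h)`, telescoping, monotone stairs,
`le_dWaveOrderParameter_of_forall`). [folklore] -/
theorem stub_slopeTransfer : ∀ (U μ h₀ m₁ Φtot : ℝ) (Φ : ℝ → ℝ), 0 < h₀ →
    (∀ J : ℕ, ∑ j ∈ Finset.range (J + 1), Φ (h₀ / 2 ^ j) ≤ Φtot) →
    m₁ ≤ liminf (fun L : ℕ => dWaveSourceDensity (L + 1) U μ h₀) atTop →
    (∀ h ∈ Set.Ioc (0:ℝ) h₀, ∀ᶠ L : ℕ in atTop,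
      ((dWaveSourceTorus (L + 1) U μ h).groundEnergy - (dWaveSourceTorus (L + 1) U μ (2 * h)).groundEnergy) / h -
        ((dWaveSourceTorus (L + 1) U μ (h / 2)).groundEnergy - (dWaveSourceTorus (L + 1) U μ h).groundEnergy) / (h / 2) ≤
        2 * Φ h * ((L + 1 : ℕ) : ℝ) ^ 2) →
    m₁ - Φtot ≤ dWaveOrderParameter U μ := by
  sorry

/-! ### Stub M2 — the Cauchy curvature budget (pure complex analysis) -/

/-- **Shell curvature budget** (line cauchy-griffiths-source-shells, stub M2; Cauchy's inequality + Taylor–Lagrange).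
If on the window `[h/2, 2h]` a real function is `E(t) = a + b·t + Σ_i Re g_i(t)` with every `g_i` holomorphic on
the ball of radius `r_i > 0` about every point `t` of the window and `‖g_i z − g_i t‖ ≤ s_i` on that ball, then
`3E(h) − E(2h) − 2E(h/2) ≤ 6 h² Σ_i s_i / r_i²` (`‖g_i''(t)‖ ≤ 8 s_i/r_i²` by
`Literature.Analysis.Complex.norm_iteratedDeriv_two_le_of_forall_mem_ball`, and
`3E(h) − E(2h) − 2E(h/2) = −(h²/2)E''(ξ₁) − (h²/4)E''(ξ₂)`). [folklore] -/
theorem stub_shellCurvatureBudget : ∀ (E : ℝ → ℝ) (h a b : ℝ) (n : ℕ) (g : Fin n → ℂ → ℂ) (r s : Fin n → ℝ),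
    0 < h → (∀ i, 0 < r i) →
    (∀ i, ∀ t ∈ Set.Icc (h / 2) (2 * h), DifferentiableOn ℂ (g i) (Metric.ball (t : ℂ) (r i)) ∧
      ∀ z ∈ Metric.ball (t : ℂ) (r i), ‖g i z - g i t‖ ≤ s i) →
    (∀ t ∈ Set.Icc (h / 2) (2 * h), E t = a + b * t + ∑ i, (g i t).re) →
    3 * E h - E (2 * h) - 2 * E (h / 2) ≤ 6 * h ^ 2 * ∑ i, s i / r i ^ 2 := by
  sorry

/-! ### Stub P — source-analytic energy shells with the top-stair floor (ALL the physics; hardest) -/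

/-- **Source-analytic shells with the top-stair floor** (line cauchy-griffiths-source-shells, stub P = the card's
Transfer `C⁺ = SourceAnalyticShells(a,b)` plus its "one massive computation at `h₀`"; the hardest stub, held by the
lead). For thresholds `(kStar, etaStar)` to be exhibited: whenever a scale datum `D` with `0 < D.meanFieldDensity.fst`
meets them and is a certified enclosure of the CT report of `dWaveSourceTorus · U μ h` for every `h ∈ (0, h₀]`, then
(a) at the top stair `(3/4)·fst ≤ liminf_L dWaveSourceDensity (L+1) U μ h₀` (phase mode massive, `ω₀(h₀)² = 2h₀m₀/κ`),
and (b) there is a stair budget `Φ` with `Σ_{j≤J} Φ(h₀/2^j) ≤ fst/4` such that at every stair `h ∈ (0,h₀]`,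
eventually in `L`, the sourced vacuum energy `t ↦ E₀(dWaveSourceTorus (L+1) U μ t)` is, on `[h/2, 2h]`, an affine
function plus finitely many real parts of functions holomorphic on the `r_i`-balls about the window with oscillation
`≤ s_i` there (the energy shells `e_ℓ`, radius `r_ℓ ≍ ρ_s ℓ²/m₀`, modulus `s_ℓ ≍ cℓ³(1+η)`, `ℓ` dyadic in
`[ω₀(h)/c, Λ₀]`, `c² = ρ_s/κ`), with curvature budget `6h Σ_i s_i/r_i² ≤ 2Φ(h)(L+1)²`. Sources for the intended
proof: Giuliani–Mastropietro CMP 293 (2010) (nodal analyticity), Balaban–O'Carroll 1999 / Dimock 2011 (inductive RG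
with shrinking analyticity domains), Salmhofer et al. 2004 §4.2 (Ward identity), Koma–Tasaki 1994 §1. Inherits R's
caveats X1 (report at Grassmann `μ` ≙ operator `μ + U/2`) and X3 (real-analyticity of `E_{L+1}` on the window at large
`L` = source-gapped uniqueness). UNPROVED. [folklore] -/
theorem stub_sourceAnalyticShells : ∃ kStar etaStar : ℚ, 0 < kStar ∧ 0 < etaStar ∧
    ∀ (U μ h₀ : ℝ) (D : HubbardScaleData), 0 < h₀ →
    (∀ h ∈ Set.Ioc (0:ℝ) h₀, ∃ L₀ : ℕ, D.IsCertifiedEnclosure (hubbardScaleReportCT U μ D h) L₀) →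
    D.MeetsThresholds kStar etaStar → 0 < D.meanFieldDensity.fst →
    (3 / 4 : ℝ) * ((D.meanFieldDensity.fst : ℚ) : ℝ) ≤ liminf (fun L : ℕ => dWaveSourceDensity (L + 1) U μ h₀) atTop ∧
    ∃ Φ : ℝ → ℝ, (∀ J : ℕ, ∑ j ∈ Finset.range (J + 1), Φ (h₀ / 2 ^ j) ≤ ((D.meanFieldDensity.fst : ℚ) : ℝ) / 4) ∧
      ∀ h ∈ Set.Ioc (0:ℝ) h₀, ∀ᶠ L : ℕ in atTop,
        ∃ (a b : ℝ) (n : ℕ) (g : Fin n → ℂ → ℂ) (r s : Fin n → ℝ),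
          (∀ i, 0 < r i) ∧
          (∀ i, ∀ t ∈ Set.Icc (h / 2) (2 * h), DifferentiableOn ℂ (g i) (Metric.ball (t : ℂ) (r i)) ∧
            ∀ z ∈ Metric.ball (t : ℂ) (r i), ‖g i z - g i t‖ ≤ s i) ∧
          (∀ t ∈ Set.Icc (h / 2) (2 * h),
            (dWaveSourceTorus (L + 1) U μ t).groundEnergy = a + b * t + ∑ i, (g i t).re) ∧
          6 * h * ∑ i, s i / r i ^ 2 ≤ 2 * Φ h * ((L + 1 : ℕ) : ℝ) ^ 2 := by
  sorry

/-! ### Composition (sorry-free): the three stubs give the crux by name -/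

/-- **The line closes the crux modulo its stubs**: `stub_sourceAnalyticShells` supplies the thresholds, the top-stair
floor `(3/4)fst` and the analytic shells with budget `Φ`, `Σ Φ ≤ fst/4`; `stub_shellCurvatureBudget` turns each shell
decomposition into the dyadic second-difference bound; `stub_slopeTransfer` carries the floor down the stairs:
`(3/4)fst − fst/4 = fst/2 ≤ dWaveOrderParameter U μ`. Data with `fst ≤ 0` conclude by `dWaveOrderParameter_nonneg`.
[folklore] -/
theorem AposterioriOrderCriterionR_of : AposterioriOrderCriterionR := by
  obtain ⟨kStar, etaStar, hk, he, HP⟩ := stub_sourceAnalyticShells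
  refine ⟨kStar, etaStar, hk, he, fun U μ h₀ D hh₀ hcert hthr => ?_⟩
  by_cases hpos : 0 < D.meanFieldDensity.fst
  · obtain ⟨hfloor, Φ, hΦsum, hshells⟩ := HP U μ h₀ D hh₀ hcert hthr hpos
    have key := stub_slopeTransfer U μ h₀ ((3 / 4 : ℝ) * ((D.meanFieldDensity.fst : ℚ) : ℝ))
      (((D.meanFieldDensity.fst : ℚ) : ℝ) / 4) Φ hh₀ hΦsum hfloor ?_
    · linarith
    · intro h hh
      filter_upwards [hshells h hh] with L hL
      obtain ⟨a, b, n, g, r, s, hr, hg, hE, hbudget⟩ := hL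
      have hcurv := stub_shellCurvatureBudget (fun t => (dWaveSourceTorus (L + 1) U μ t).groundEnergy) h a b n g r s
        hh.1 hr hg hE
      have hh0 : (0:ℝ) < h := hh.1
      have hsum_nonneg : 6 * h * ∑ i, s i / r i ^ 2 ≤ 2 * Φ h * ((L + 1 : ℕ) : ℝ) ^ 2 := hbudget
      -- divide the three-point bound by `h`
      have : (3 * (dWaveSourceTorus (L + 1) U μ h).groundEnergy - (dWaveSourceTorus (L + 1) U μ (2 * h)).groundEnergy -
          2 * (dWaveSourceTorus (L + 1) U μ (h / 2)).groundEnergy) / h ≤ 6 * h * ∑ i, s i / r i ^ 2 := by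
        rw [div_le_iff₀ hh0]
        simpa [pow_two, mul_comm, mul_left_comm, mul_assoc] using hcurv
      have hrew : ((dWaveSourceTorus (L + 1) U μ h).groundEnergy - (dWaveSourceTorus (L + 1) U μ (2 * h)).groundEnergy) / h -
          ((dWaveSourceTorus (L + 1) U μ (h / 2)).groundEnergy - (dWaveSourceTorus (L + 1) U μ h).groundEnergy) / (h / 2) =
          (3 * (dWaveSourceTorus (L + 1) U μ h).groundEnergy - (dWaveSourceTorus (L + 1) U μ (2 * h)).groundEnergy -
          2 * (dWaveSourceTorus (L + 1) U μ (h / 2)).groundEnergy) / h := by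
        field_simp
        ring
      rw [hrew]
      exact this.trans hsum_nonneg
  · have hD : ((D.meanFieldDensity.fst : ℚ) : ℝ) ≤ 0 := by exact_mod_cast (not_lt.1 hpos)
    linarith [dWaveOrderParameter_nonneg U μ]

end Summit.HubbardSuperconductivity.HubbardSuperconductivity.Theorems
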